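/-
Copyright: cell `pub-balaban-gaps` (G2), seat ne6 (row NE7b), `prover-pub-balaban-gaps-ne6-g19-0`. Project licence.
-/
import Summits.QuantumFields.BalabanUV.T4Continuum.Spine.NE7b.CompactFibrePlaquetteMassSUNLimit
import Summits.QuantumFields.BalabanUV.T4Continuum.Spine.NE7b.CompactFibreMeanActionSUNMonotone
import Summits.QuantumFields.BalabanUV.T4Continuum.Spine.NE7b.CompactFibreMeanActionSUNLimit
import Summits.QuantumFields.BalabanUV.T4Continuum.Spine.NE7b.CompactFibreWindowSU2DoublingHaar
import Mathlib.Analysis.Calculus.Deriv.Slope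
import Mathlib.Analysis.Calculus.Deriv.MeanValue

/-!
# THE `N ≥ 3` MONOTONICITY OF THE SCALED ONE-PLAQUETTE MASS `(√β)^{N²−1}·Z_N(β)`, REDUCED: window doubling with constant `D` makes it `D`-QUASI-NON-DECREASING for
# EVERY `N` (unconditionally, with V38's `D`); it is NON-DECREASING on `(0,∞)` IFF the EQUIPARTITION INEQUALITY `β·⟨Re tr(1−V)⟩_β ≤ (N²−1)∕2` holds at every `β > 0`
# (⟸ the SHARP doubling); and it IS non-decreasing wherever `−log Z_N(β) ≤ (N²−1)∕2`, so on `[0, (N²−1)∕(2N)]`, every `N ≥ 2` (row NE7b; MODEL, [folklore]; census V52)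

Cell `pub-balaban-gaps` (G2 spine census) for the `pub-balaban` T⁴ crux NE7b (`T4WeightBudget.RelWeightBound`; NOT PRINTED, NOT PROVED).  Crux-route work under `Spine/NE7b/`;
imports this lineage's V48 `CompactFibrePlaquetteMassSUNLimit` (layer cake in Laplace form `integral_exp_neg_mul_eq_integral_window`), V50 `CompactFibreMeanActionSUNMonotone`
(`hasDerivAt_plaquetteMass_SUN`, `freeEnergy_SUN_monotoneOn`, `freeEnergy_SUN_le`), V49 `CompactFibreMeanActionSUNLimit` (`mul_meanAction_le_freeEnergy`), V40b-Haar `CompactFibreWindowSU2DoublingHaar` (`haarReal_traceWindow_doubling_one`, the SU(2)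
doubling with `D = 1`) — through them V38 (`exists_haarReal_traceWindow_doubling`, measurability) and V35 (`re_trace_one_sub_nonneg`) — + Mathlib
(`monotoneOn_of_hasDerivWithinAt_nonneg`, `HasDerivWithinAt.nonneg_of_monotoneOn`, `HasDerivAt.log`); no `def`, zero `sorry`, nothing of Bałaban's
asserted.  V44's `scaled_plaquetteMass_SU2_monotoneOn` ∕ `mean_action_lt_equipartition` and J4's ∕ seat ne8's limit theorems are NOT restated (§6: `example`s; §5: hypothesis).

THE LOCATED QUESTION (census V52).  Row NE7b's record (`ne/NE7b.md` v1.28.1; BALABAN-GAPS l.54 after pen g18b) carries ONE remaining «not treated — real reason» clause in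
the one-plaquette family: the MONOTONICITY of `f_N(β) = (√β)^{N²−1}·Z_N(β)`, `Z_N(β) = ∫ e^{−β·Re tr(1−V)} dHaar_{SU(N)}(V)`, for `N ≥ 3` (V44: `f_2` strictly increasing by
Weyl's formula; gens 17∕18: «needs the rank-(N−1) Weyl formula ∕ the sharp doubling for SU(N) — absent»).  QUESTION: what EXACTLY does the monotonicity need, can the need
be NAMED as one inequality in the kernel, and how much holds unconditionally?  ANSWER ([folklore]; layer cake + one-variable calculus; chart-free):
* §1 ABSTRACT (finite measure, deficit `s ≥ 0` measurable, `m(t) = μ{s ≤ t}`): **`sqrt_pow_mul_integral_exp_neg_mul_le_of_doubling`** — window doubling `m(λ²t) ≤ D·λ^d·m(t)`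
  (`λ ≥ 1`, all real `t`) gives `(√β₁)^d·∫e^{−β₁s}dμ ≤ D·(√β₂)^d·∫e^{−β₂s}dμ` for `0 < β₁ ≤ β₂` (pointwise in the Laplace variable with `λ = √(β₂∕β₁)`, then
  `integral_mono_of_nonneg`); `D = 1` ⟹ `MonotoneOn … (Ioi 0)`; **`doubling_one_of_antitoneOn`** ∕ **`antitoneOn_of_doubling_one`**: the sharp doubling for all real `t`
  IS the antitonicity of `t ↦ m(t)∕(√t)^d` on `(0,∞)` (the window volume never outgrows its small-window power law).
* §2 `SU(N)`, EVERY `N`, UNCONDITIONAL: **`exists_scaled_plaquetteMass_SUN_quasiMonotone`** (`∃ D ≥ 1, ∀ 0 < β₁ ≤ β₂, f_N(β₁) ≤ D·f_N(β₂)`, V38's `D`); CONDITIONAL on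
  the sharp doubling: **`scaled_plaquetteMass_SUN_monotoneOn_of_doubling_one`** (`Ioi 0`), **`…_Ici_of_doubling_one`** (`Ici 0`, `N ≥ 2`).
* §3 EVERY `N`: **`hasDerivAt_log_scaled_plaquetteMass_SUN`** (`(log f_N)′ = ((N²−1)∕2)·β⁻¹ − ⟨s⟩_β`), **`scaled_plaquetteMass_SUN_monotoneOn_of_equipartition_le`** (local
  form on a convex `D ⊆ (0,∞)`), **`scaled_plaquetteMass_SUN_monotoneOn_iff_equipartition_le`**: `MonotoneOn f_N (Ioi 0) ↔ ∀ β > 0, β·⟨Re tr(1−V)⟩_β ≤ (N²−1)∕2` — the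
  monotonicity IS the statement that the tilted mean action never exceeds its equipartition value `dim SU(N)∕(2β)` (J4: `β⟨s⟩_β → (N²−1)∕2`; V44 §8: `< 3∕2`, N = 2);
  **`equipartition_le_of_doubling_one`**.
* §4 EVERY `N`, UNCONDITIONAL: **`scaled_plaquetteMass_SUN_monotoneOn_freeEnergyWindow`** — `f_N` non-decreasing on the FREE-ENERGY WINDOW `{β ≥ 0 ∣ −log Z_N(β) ≤ (N²−1)∕2}`
  (V49's tangent-line Jensen `β⟨s⟩_β ≤ −log Z_N(β)`; an interval, `freeEnergyWindow_ordConnected`) ⊇ `[0, (N²−1)∕(2N)]` (V50's `−log Z_N(β) ≤ Nβ`):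
  **`scaled_plaquetteMass_SUN_monotoneOn_strongCoupling`** (`N ≥ 2`; `N = 3`: `[0, 4∕3]`).
* §5 **`scaled_plaquetteMass_SUN_le_mul_lim`** — with V38's `D` and ANY limit `f_N → c` (J4 ∕ ne8's file 46 give `c = K_N = G(N+1)∕(√N(2π)^{(N−1)∕2})`; a HYPOTHESIS here,
  their modules not imported): `f_N(β) ≤ D·c` at EVERY `β > 0`.
* §6 `N = 2` SANITY (`example`s): V40b-Haar's `D = 1` feeds §2∕§3 — `f_2` non-decreasing on `[0,∞)` and `β⟨s⟩_β ≤ 3∕2`, without Weyl's derivative formula.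
SO THE RESIDUAL FOR `N ≥ 3` IS ONE NAMED HAAR INEQUALITY — the sharp trace-window doubling (⟺ antitone window ratio) ⟹ equipartition inequality ⟺ monotonicity.

HONEST REMARKS.  (i) MODEL ∕ [folklore]: ONE plaquette variable under Haar (the compact-fibre carrier's product reference state factorises); nothing of the interacting
measure.  (ii) The sharp doubling for `N ≥ 3` is NOT proved here (nor the equipartition inequality beyond the free-energy window): it is the named residual, screened by
value for `N = 3` at zero weight in the seat's packet; `D = 1` is known for `N = 2` only (V40b).  (iii) No strictness claimed.  (iv) (A3) ∕ (A1c) NOT asserted; NC-NE7b-α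
UNRULED.  BY-NAME EFFECT ON THE WALL: NONE.  NE7b NOT PRINTED ∕ NOT PROVED; spine PROVED 0∕9; rung (B)+1 on ONE finite T⁴ — NOT infinite volume, NOT the mass gap, NOT Clay.
HONEST DEPENDENCY: continuum YM on T⁴ ⇐ BetaPertH ∧ nine spine estimates (0/9 proved); BetaPertH ⇐ (D1) ∧ (D4) ∧ CAP+tail;
G-an2-4 gates asym, D1 and NE2/3/4.  This file changes none of it.
-/

set_option autoImplicit false

noncomputable section

open MeasureTheory Real Set Filter Topology
open scoped Matrix.Norms.Frobenius
open Literature.MathematicalPhysics.QuantumFieldTheory (haarProbability)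
open Summit.QuantumFields.BalabanUV.T4Continuum.NE7b.CompactFibreHalvedActionSUN (measurable_re_trace_one_sub exists_haarReal_traceWindow_doubling)
open Summit.QuantumFields.BalabanUV.T4Continuum.NE7b.CompactFibreProfileVolumeSUN (re_trace_one_sub_nonneg)
open Summit.QuantumFields.BalabanUV.T4Continuum.NE7b.CompactFibrePlaquetteMassSUNLimit (integral_exp_neg_mul_eq_integral_window sqrt_pow_eq_rpow)
open Summit.QuantumFields.BalabanUV.T4Continuum.NE7b.CompactFibreMeanActionSUNMonotone (hasDerivAt_plaquetteMass_SUN plaquetteMass_SUN_pos_real freeEnergy_SUN_monotoneOn freeEnergy_SUN_le)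
open Summit.QuantumFields.BalabanUV.T4Continuum.NE7b.CompactFibreMeanActionSUNLimit (mul_meanAction_le_freeEnergy)
open Summit.QuantumFields.BalabanUV.T4Continuum.NE7b.CompactFibreWindowSU2DoublingHaar (haarReal_traceWindow_doubling_one)

namespace Summit.QuantumFields.BalabanUV.T4Continuum.NE7b.CompactFibrePlaquetteMassSUNQuasiMonotone

/-! ## §1 The abstract quasi-monotonicity theorem: window doubling controls the scaled Laplace transform along the coupling -/

section Abstract

variable {X : Type*} [MeasurableSpace X] (μ : Measure X)

/-- **POINTWISE IN THE LAPLACE VARIABLE.**  Window doubling `μ{s ≤ λ²t} ≤ D·λ^d·μ{s ≤ t}` (`λ ≥ 1`, all real `t`) gives, for `0 < β₁ ≤ β₂` and every `u`,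
`(√β₁)^d·μ{s ≤ u∕β₁} ≤ D·(√β₂)^d·μ{s ≤ u∕β₂}` (take `λ = √(β₂∕β₁)`, so that `λ²·(u∕β₂) = u∕β₁` and `(√β₁)^d·λ^d = (√β₂)^d`). [folklore] -/
theorem sqrt_pow_mul_window_le_of_doubling {s : X → ℝ} {d : ℕ} {D : ℝ}
    (hD : ∀ l : ℝ, 1 ≤ l → ∀ t : ℝ, μ.real {x | s x ≤ l ^ 2 * t} ≤ D * l ^ d * μ.real {x | s x ≤ t})
    {β₁ β₂ : ℝ} (hβ₁ : 0 < β₁) (h12 : β₁ ≤ β₂) (u : ℝ) :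
    Real.sqrt β₁ ^ d * μ.real {x | s x ≤ u / β₁} ≤ D * (Real.sqrt β₂ ^ d * μ.real {x | s x ≤ u / β₂}) := by
  have hβ₂ : 0 < β₂ := hβ₁.trans_le h12
  have hs₁ : 0 < Real.sqrt β₁ := Real.sqrt_pos.2 hβ₁
  have hs₁' : Real.sqrt β₁ ≠ 0 := hs₁.ne'
  have hl2 : Real.sqrt (β₂ / β₁) ^ 2 * (u / β₂) = u / β₁ := by rw [Real.sq_sqrt (div_pos hβ₂ hβ₁).le]; field_simp
  have hld : Real.sqrt β₁ ^ d * Real.sqrt (β₂ / β₁) ^ d = Real.sqrt β₂ ^ d := by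
    rw [← mul_pow, Real.sqrt_div hβ₂.le β₁]; congr 1; field_simp
  have key := hD _ (Real.one_le_sqrt.2 ((one_le_div hβ₁).2 h12)) (u / β₂)
  rw [hl2] at key
  calc Real.sqrt β₁ ^ d * μ.real {x | s x ≤ u / β₁} ≤ Real.sqrt β₁ ^ d * (D * Real.sqrt (β₂ / β₁) ^ d * μ.real {x | s x ≤ u / β₂}) :=
        mul_le_mul_of_nonneg_left key (pow_nonneg hs₁.le d)
    _ = D * ((Real.sqrt β₁ ^ d * Real.sqrt (β₂ / β₁) ^ d) * μ.real {x | s x ≤ u / β₂}) := by ring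
    _ = D * (Real.sqrt β₂ ^ d * μ.real {x | s x ≤ u / β₂}) := by rw [hld]

/-- **THE QUASI-MONOTONICITY THEOREM.**  On a finite measure space with a measurable deficit `s ≥ 0`: window doubling with constant `D`,
`μ{s ≤ λ²t} ≤ D·λ^d·μ{s ≤ t}` for all `λ ≥ 1` and all real `t`, makes the scaled Laplace transform `D`-quasi-non-decreasing along the coupling:
`(√β₁)^d·∫ e^{−β₁·s} dμ ≤ D·(√β₂)^d·∫ e^{−β₂·s} dμ` for all `0 < β₁ ≤ β₂` (the layer cake `∫ e^{−βs} dμ = ∫_{(0,∞)} e^{−u}·μ{s ≤ u∕β} du` on both sides and the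
pointwise comparison `sqrt_pow_mul_window_le_of_doubling`). [folklore] -/
theorem sqrt_pow_mul_integral_exp_neg_mul_le_of_doubling [IsFiniteMeasure μ] {s : X → ℝ} (hs : Measurable s) (hs0 : ∀ x, 0 ≤ s x) {d : ℕ} {D : ℝ}
    (hD : ∀ l : ℝ, 1 ≤ l → ∀ t : ℝ, μ.real {x | s x ≤ l ^ 2 * t} ≤ D * l ^ d * μ.real {x | s x ≤ t})
    {β₁ β₂ : ℝ} (hβ₁ : 0 < β₁) (h12 : β₁ ≤ β₂) :
    Real.sqrt β₁ ^ d * ∫ x, Real.exp (-(β₁ * s x)) ∂μ ≤ D * (Real.sqrt β₂ ^ d * ∫ x, Real.exp (-(β₂ * s x)) ∂μ) := by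
  have hβ₂ : 0 < β₂ := hβ₁.trans_le h12
  rw [integral_exp_neg_mul_eq_integral_window μ hs hs0 hβ₁, integral_exp_neg_mul_eq_integral_window μ hs hs0 hβ₂,
    ← integral_const_mul (Real.sqrt β₁ ^ d), ← integral_const_mul (Real.sqrt β₂ ^ d), ← integral_const_mul D]
  -- integrability of the dominating side
  have hmono : Monotone fun u : ℝ => μ.real {x | s x ≤ u / β₂} := fun u v huv =>
    measureReal_mono (fun x (hx : s x ≤ u / β₂) => hx.trans (div_le_div_of_nonneg_right huv hβ₂.le))
  have hmeas : AEStronglyMeasurable (fun u : ℝ => D * (Real.sqrt β₂ ^ d * (Real.exp (-u) * μ.real {x | s x ≤ u / β₂})))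
      (volume.restrict (Set.Ioi (0 : ℝ))) :=
    (measurable_const.mul (measurable_const.mul ((Real.measurable_exp.comp measurable_neg).mul hmono.measurable))).aestronglyMeasurable
  have hint : Integrable (fun u : ℝ => D * (Real.sqrt β₂ ^ d * (Real.exp (-u) * μ.real {x | s x ≤ u / β₂})))
      (volume.restrict (Set.Ioi (0 : ℝ))) := by
    refine Integrable.mono' ((integrableOn_exp_neg_Ioi 0).const_mul (|D| * (Real.sqrt β₂ ^ d * μ.real Set.univ))) hmeas
      (ae_of_all _ fun u => ?_)
    have h1 : Real.exp (-u) * μ.real {x | s x ≤ u / β₂} ≤ Real.exp (-u) * μ.real Set.univ := mul_le_mul_of_nonneg_left (measureReal_mono (Set.subset_univ _)) (Real.exp_pos _).le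
    have h2 := mul_le_mul_of_nonneg_left h1 (pow_nonneg (Real.sqrt_nonneg β₂) d)
    rw [Real.norm_eq_abs, abs_mul,
      abs_of_nonneg (mul_nonneg (pow_nonneg (Real.sqrt_nonneg _) d) (mul_nonneg (Real.exp_pos _).le measureReal_nonneg))]
    calc |D| * (Real.sqrt β₂ ^ d * (Real.exp (-u) * μ.real {x | s x ≤ u / β₂}))
        ≤ |D| * (Real.sqrt β₂ ^ d * (Real.exp (-u) * μ.real Set.univ)) := mul_le_mul_of_nonneg_left h2 (abs_nonneg D)
      _ = |D| * (Real.sqrt β₂ ^ d * μ.real Set.univ) * Real.exp (-u) := by ring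
  refine integral_mono_of_nonneg (ae_of_all _ fun u => ?_) hint (ae_of_all _ fun u => ?_)
  · exact mul_nonneg (pow_nonneg (Real.sqrt_nonneg _) d) (mul_nonneg (Real.exp_pos _).le measureReal_nonneg)
  · have hpt := sqrt_pow_mul_window_le_of_doubling μ hD hβ₁ h12 u
    calc Real.sqrt β₁ ^ d * (Real.exp (-u) * μ.real {x | s x ≤ u / β₁})
        = Real.exp (-u) * (Real.sqrt β₁ ^ d * μ.real {x | s x ≤ u / β₁}) := by ring
      _ ≤ Real.exp (-u) * (D * (Real.sqrt β₂ ^ d * μ.real {x | s x ≤ u / β₂})) := mul_le_mul_of_nonneg_left hpt (Real.exp_pos _).le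
      _ = D * (Real.sqrt β₂ ^ d * (Real.exp (-u) * μ.real {x | s x ≤ u / β₂})) := by ring

/-- **SHARP DOUBLING GIVES MONOTONICITY.**  With `D = 1` the scaled Laplace transform `β ↦ (√β)^d·∫ e^{−β·s} dμ` is non-decreasing on `(0, ∞)`. [folklore] -/
theorem sqrt_pow_mul_integral_exp_neg_mul_monotoneOn_of_doubling_one [IsFiniteMeasure μ] {s : X → ℝ} (hs : Measurable s) (hs0 : ∀ x, 0 ≤ s x) {d : ℕ}
    (hD : ∀ l : ℝ, 1 ≤ l → ∀ t : ℝ, μ.real {x | s x ≤ l ^ 2 * t} ≤ l ^ d * μ.real {x | s x ≤ t}) :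
    MonotoneOn (fun β : ℝ => Real.sqrt β ^ d * ∫ x, Real.exp (-(β * s x)) ∂μ) (Set.Ioi 0) := by
  intro β₁ hβ₁ β₂ _ h12
  have h := sqrt_pow_mul_integral_exp_neg_mul_le_of_doubling μ hs hs0 (D := 1) (fun l hl t => by simpa only [one_mul] using hD l hl t) hβ₁ h12
  simpa only [one_mul] using h

/-- **THE SHARP DOUBLING IS THE ANTITONICITY OF THE WINDOW RATIO** (one direction): if `t ↦ μ{s ≤ t}∕(√t)^d` is antitone on `(0,∞)` and `s ≥ 0`, then
`μ{s ≤ λ²t} ≤ λ^d·μ{s ≤ t}` for all `λ ≥ 1` and all real `t` (for `t < 0` both windows are empty; for `t = 0` use `λ^d ≥ 1`). [folklore] -/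
theorem doubling_one_of_antitoneOn {s : X → ℝ} (hs0 : ∀ x, 0 ≤ s x) {d : ℕ}
    (hA : AntitoneOn (fun t : ℝ => μ.real {x | s x ≤ t} / Real.sqrt t ^ d) (Set.Ioi 0)) :
    ∀ l : ℝ, 1 ≤ l → ∀ t : ℝ, μ.real {x | s x ≤ l ^ 2 * t} ≤ l ^ d * μ.real {x | s x ≤ t} := by
  intro l hl t
  have hl0 : 0 < l := by linarith
  have hld : 1 ≤ l ^ d := one_le_pow₀ hl
  rcases lt_trichotomy t 0 with ht | rfl | ht
  · have h1 : {x | s x ≤ l ^ 2 * t} = ∅ := Set.eq_empty_of_forall_notMem fun x (hx : s x ≤ l ^ 2 * t) => by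
      linarith [hs0 x, mul_neg_of_pos_of_neg (by positivity : (0 : ℝ) < l ^ 2) ht]
    rw [h1, measureReal_empty]; exact mul_nonneg (by positivity) measureReal_nonneg
  · rw [mul_zero]
    exact le_mul_of_one_le_left measureReal_nonneg hld
  · have hlt : 0 < l ^ 2 * t := by positivity
    have hle : t ≤ l ^ 2 * t := le_mul_of_one_le_left ht.le (one_le_pow₀ hl)
    have key := hA ht hlt hle
    have hsq : Real.sqrt (l ^ 2 * t) ^ d = l ^ d * Real.sqrt t ^ d := by rw [Real.sqrt_mul (sq_nonneg l), Real.sqrt_sq hl0.le, mul_pow]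
    have hst' : Real.sqrt t ^ d ≠ 0 := (pow_pos (Real.sqrt_pos.2 ht) d).ne'
    simp only [hsq] at key
    calc μ.real {x | s x ≤ l ^ 2 * t} ≤ μ.real {x | s x ≤ t} / Real.sqrt t ^ d * (l ^ d * Real.sqrt t ^ d) :=
          (div_le_iff₀ (by positivity : (0 : ℝ) < l ^ d * Real.sqrt t ^ d)).1 key
      _ = l ^ d * μ.real {x | s x ≤ t} := by field_simp

/-- Converse: the sharp doubling for all real `t` makes `t ↦ μ{s ≤ t}∕(√t)^d` antitone on `(0,∞)` (for `0 < a ≤ b` take `λ = √(b∕a)`). [folklore] -/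
theorem antitoneOn_of_doubling_one {s : X → ℝ} {d : ℕ}
    (hD : ∀ l : ℝ, 1 ≤ l → ∀ t : ℝ, μ.real {x | s x ≤ l ^ 2 * t} ≤ l ^ d * μ.real {x | s x ≤ t}) :
    AntitoneOn (fun t : ℝ => μ.real {x | s x ≤ t} / Real.sqrt t ^ d) (Set.Ioi 0) := by
  intro a ha b _ hab
  have ha' : 0 < a := ha
  have hb' : 0 < b := ha'.trans_le hab
  have hsa : 0 < Real.sqrt a := Real.sqrt_pos.2 ha'
  have hsa' : Real.sqrt a ≠ 0 := hsa.ne'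
  have hl2 : Real.sqrt (b / a) ^ 2 * a = b := by rw [Real.sq_sqrt (div_pos hb' ha').le]; field_simp
  have key := hD _ (Real.one_le_sqrt.2 ((one_le_div ha').2 hab)) a
  rw [hl2, Real.sqrt_div hb'.le a, div_pow] at key
  have hsad : 0 < Real.sqrt a ^ d := pow_pos hsa d
  show μ.real {x | s x ≤ b} / Real.sqrt b ^ d ≤ μ.real {x | s x ≤ a} / Real.sqrt a ^ d
  rw [div_le_div_iff₀ (pow_pos (Real.sqrt_pos.2 hb') d) hsad]
  calc μ.real {x | s x ≤ b} * Real.sqrt a ^ d ≤ Real.sqrt b ^ d / Real.sqrt a ^ d * μ.real {x | s x ≤ a} * Real.sqrt a ^ d :=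
        mul_le_mul_of_nonneg_right key hsad.le
    _ = μ.real {x | s x ≤ a} * Real.sqrt b ^ d := by field_simp

/-- Endpoint bookkeeping: a function non-decreasing on a set `T ⊆ (0,∞)`, vanishing at `0` and non-negative on `T`, is non-decreasing on any set `S` whose points are
`0` or in `T` (used with `S = [0,∞)`, `T = (0,∞)` and `S = [0,b]`, `T = (0,b]`). -/
theorem monotoneOn_insert_zero {f : ℝ → ℝ} {S T : Set ℝ} (hST : ∀ x ∈ S, x = 0 ∨ x ∈ T) (hT : T ⊆ Set.Ioi 0)
    (hmono : MonotoneOn f T) (h0 : f 0 = 0) (hnn : ∀ x ∈ T, 0 ≤ f x) : MonotoneOn f S := by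
  intro a ha b hb hab
  rcases hST a ha with rfl | ha'
  · rcases hST b hb with rfl | hb'
    · exact le_rfl
    · rw [h0]; exact hnn b hb'
  · rcases hST b hb with rfl | hb'
    · exact absurd hab (not_le.2 (hT ha'))
    · exact hmono ha' hb' hab

end Abstract

/-! ## §2 `SU(N)`, every `N`: quasi-monotonicity of the scaled one-plaquette mass, unconditionally; monotonicity under the sharp doubling -/

section SUN

variable {N : ℕ}

/-- **THE SCALED ONE-PLAQUETTE MASS IS QUASI-NON-DECREASING, EVERY `N`, UNCONDITIONALLY**: with V38's window-doubling constant `D ≥ 1` of `SU(N)`,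
`(√β₁)^{N²−1}·Z_N(β₁) ≤ D·(√β₂)^{N²−1}·Z_N(β₂)` for all `0 < β₁ ≤ β₂`, `Z_N(β) = ∫ e^{−β·Re tr(1−V)} dHaar_{SU(N)}(V)` — the scaled mass never drops by more than the
factor `D` as the coupling weakens (no chart, no Weyl). [folklore] -/
theorem exists_scaled_plaquetteMass_SUN_quasiMonotone : ∃ D : ℝ, 1 ≤ D ∧ ∀ β₁ β₂ : ℝ, 0 < β₁ → β₁ ≤ β₂ →
    Real.sqrt β₁ ^ (N ^ 2 - 1) * ∫ V, Real.exp (-(β₁ * (Matrix.trace (1 - (V : Matrix (Fin N) (Fin N) ℂ))).re)) ∂(haarProbability (Matrix.specialUnitaryGroup (Fin N) ℂ)) ≤ D * (Real.sqrt β₂ ^ (N ^ 2 - 1) * ∫ V, Real.exp (-(β₂ * (Matrix.trace (1 - (V : Matrix (Fin N) (Fin N) ℂ))).re)) ∂(haarProbability (Matrix.specialUnitaryGroup (Fin N) ℂ))) := by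
  obtain ⟨D, hD1, hD⟩ := exists_haarReal_traceWindow_doubling (N := N)
  exact ⟨D, hD1, fun β₁ β₂ hβ₁ h12 => sqrt_pow_mul_integral_exp_neg_mul_le_of_doubling _ measurable_re_trace_one_sub re_trace_one_sub_nonneg hD hβ₁ h12⟩

/-- **THE SHARP DOUBLING GIVES THE MONOTONICITY, EVERY `N`**: if `Haar_{SU(N)}{Re tr(1−V) ≤ λ²t} ≤ λ^{N²−1}·Haar_{SU(N)}{Re tr(1−V) ≤ t}` for all `λ ≥ 1` and all real
`t` (V38's doubling with `D = 1`; PROVED for `N = 2` in V40b-Haar, NOT proved for `N ≥ 3`), then `β ↦ (√β)^{N²−1}·Z_N(β)` is non-decreasing on `(0,∞)`. [folklore] -/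
theorem scaled_plaquetteMass_SUN_monotoneOn_of_doubling_one (hD : ∀ l : ℝ, 1 ≤ l → ∀ t : ℝ,
      (haarProbability (Matrix.specialUnitaryGroup (Fin N) ℂ)).real {V : Matrix.specialUnitaryGroup (Fin N) ℂ | (Matrix.trace (1 - (V : Matrix (Fin N) (Fin N) ℂ))).re ≤ l ^ 2 * t} ≤ l ^ (N ^ 2 - 1) * (haarProbability (Matrix.specialUnitaryGroup (Fin N) ℂ)).real {V : Matrix.specialUnitaryGroup (Fin N) ℂ | (Matrix.trace (1 - (V : Matrix (Fin N) (Fin N) ℂ))).re ≤ t}) :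
    MonotoneOn (fun β : ℝ => Real.sqrt β ^ (N ^ 2 - 1) * ∫ V, Real.exp (-(β * (Matrix.trace (1 - (V : Matrix (Fin N) (Fin N) ℂ))).re)) ∂(haarProbability (Matrix.specialUnitaryGroup (Fin N) ℂ))) (Set.Ioi 0) :=
  sqrt_pow_mul_integral_exp_neg_mul_monotoneOn_of_doubling_one _ measurable_re_trace_one_sub re_trace_one_sub_nonneg hD

/-- The scaled mass is non-negative at every real `β`. [folklore] -/
theorem scaled_plaquetteMass_SUN_nonneg (β : ℝ) : 0 ≤ Real.sqrt β ^ (N ^ 2 - 1) * ∫ V, Real.exp (-(β * (Matrix.trace (1 - (V : Matrix (Fin N) (Fin N) ℂ))).re)) ∂(haarProbability (Matrix.specialUnitaryGroup (Fin N) ℂ)) :=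
  mul_nonneg (pow_nonneg (Real.sqrt_nonneg _) _) (plaquetteMass_SUN_pos_real β).le

/-- The scaled mass vanishes at `β = 0` once `N ≥ 2` (`(√0)^{N²−1} = 0`). [folklore] -/
theorem scaled_plaquetteMass_SUN_zero (hN : 2 ≤ N) : Real.sqrt 0 ^ (N ^ 2 - 1) * ∫ V, Real.exp (-(0 * (Matrix.trace (1 - (V : Matrix (Fin N) (Fin N) ℂ))).re)) ∂(haarProbability (Matrix.specialUnitaryGroup (Fin N) ℂ)) = 0 := by
  have : 4 ≤ N ^ 2 := by nlinarith
  rw [Real.sqrt_zero, zero_pow (by omega), zero_mul]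

/-- `Ici` form of `scaled_plaquetteMass_SUN_monotoneOn_of_doubling_one` for `N ≥ 2` (the scaled mass is `0` at `β = 0` and non-negative). [folklore] -/
theorem scaled_plaquetteMass_SUN_monotoneOn_Ici_of_doubling_one (hN : 2 ≤ N) (hD : ∀ l : ℝ, 1 ≤ l → ∀ t : ℝ,
      (haarProbability (Matrix.specialUnitaryGroup (Fin N) ℂ)).real {V : Matrix.specialUnitaryGroup (Fin N) ℂ | (Matrix.trace (1 - (V : Matrix (Fin N) (Fin N) ℂ))).re ≤ l ^ 2 * t} ≤ l ^ (N ^ 2 - 1) * (haarProbability (Matrix.specialUnitaryGroup (Fin N) ℂ)).real {V : Matrix.specialUnitaryGroup (Fin N) ℂ | (Matrix.trace (1 - (V : Matrix (Fin N) (Fin N) ℂ))).re ≤ t}) :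
    MonotoneOn (fun β : ℝ => Real.sqrt β ^ (N ^ 2 - 1) * ∫ V, Real.exp (-(β * (Matrix.trace (1 - (V : Matrix (Fin N) (Fin N) ℂ))).re)) ∂(haarProbability (Matrix.specialUnitaryGroup (Fin N) ℂ))) (Set.Ici 0) :=
  monotoneOn_insert_zero (S := Set.Ici 0) (T := Set.Ioi 0) (fun _ hx => (Set.mem_Ici.1 hx).eq_or_lt.imp Eq.symm id) subset_rfl
    (scaled_plaquetteMass_SUN_monotoneOn_of_doubling_one hD) (scaled_plaquetteMass_SUN_zero hN) (fun x _ => scaled_plaquetteMass_SUN_nonneg x)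

end SUN

/-! ## §3 Every `N`: monotonicity of the scaled mass ⟺ the equipartition inequality `β·⟨Re tr(1−V)⟩_β ≤ (N²−1)∕2` at every `β > 0` -/

section Equipartition

variable {N : ℕ}

/-- For `β > 0` the scaled mass is an exponential: `(√β)^{N²−1}·Z_N(β) = exp(((N²−1)∕2)·log β + log Z_N(β))`. [folklore] -/
theorem scaled_plaquetteMass_SUN_eq_exp {β : ℝ} (hβ : 0 < β) : Real.sqrt β ^ (N ^ 2 - 1) * ∫ V, Real.exp (-(β * (Matrix.trace (1 - (V : Matrix (Fin N) (Fin N) ℂ))).re)) ∂(haarProbability (Matrix.specialUnitaryGroup (Fin N) ℂ))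
      = Real.exp (((N ^ 2 - 1 : ℕ) : ℝ) / 2 * Real.log β + Real.log (∫ V, Real.exp (-(β * (Matrix.trace (1 - (V : Matrix (Fin N) (Fin N) ℂ))).re)) ∂(haarProbability (Matrix.specialUnitaryGroup (Fin N) ℂ)))) := by
  rw [Real.exp_add, Real.exp_log (plaquetteMass_SUN_pos_real β), sqrt_pow_eq_rpow hβ.le, Real.rpow_def_of_pos hβ, mul_comm (Real.log β)]

/-- **THE LOGARITHMIC DERIVATIVE OF THE SCALED MASS**: for `β > 0`, `d∕dβ [((N²−1)∕2)·log β + log Z_N(β)] = ((N²−1)∕2)·β⁻¹ + (−∫ s e^{−βs})∕Z_N(β)`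
(`s = Re tr(1−V)`; V50's `Z_N′ = −∫ s e^{−βs}`), i.e. `(N²−1)∕(2β) − ⟨s⟩_β`. [folklore] -/
theorem hasDerivAt_log_scaled_plaquetteMass_SUN {β : ℝ} (hβ : 0 < β) :
    HasDerivAt (fun β : ℝ => ((N ^ 2 - 1 : ℕ) : ℝ) / 2 * Real.log β + Real.log (∫ V, Real.exp (-(β * (Matrix.trace (1 - (V : Matrix (Fin N) (Fin N) ℂ))).re)) ∂(haarProbability (Matrix.specialUnitaryGroup (Fin N) ℂ))))
      (((N ^ 2 - 1 : ℕ) : ℝ) / 2 * β⁻¹ + -(∫ V, (Matrix.trace (1 - (V : Matrix (Fin N) (Fin N) ℂ))).re * Real.exp (-(β * (Matrix.trace (1 - (V : Matrix (Fin N) (Fin N) ℂ))).re)) ∂(haarProbability (Matrix.specialUnitaryGroup (Fin N) ℂ))) / ∫ V, Real.exp (-(β * (Matrix.trace (1 - (V : Matrix (Fin N) (Fin N) ℂ))).re)) ∂(haarProbability (Matrix.specialUnitaryGroup (Fin N) ℂ))) β :=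
  ((Real.hasDerivAt_log hβ.ne').const_mul _).add ((hasDerivAt_plaquetteMass_SUN β).log (plaquetteMass_SUN_pos_real β).ne')

/-- **THE EQUIPARTITION INEQUALITY GIVES THE MONOTONICITY (local form).**  On any convex `D ⊆ (0,∞)`: if `β·⟨Re tr(1−V)⟩_β ≤ (N²−1)∕2` at every `β` of the
interior of `D`, then `β ↦ (√β)^{N²−1}·Z_N(β)` is non-decreasing on `D` (the logarithm has derivative `((N²−1)∕2 − β⟨s⟩_β)∕β ≥ 0` on the interior; Mathlib's
`monotoneOn_of_hasDerivWithinAt_nonneg`). [folklore] -/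
theorem scaled_plaquetteMass_SUN_monotoneOn_of_equipartition_le {D : Set ℝ} (hDc : Convex ℝ D) (hD0 : D ⊆ Set.Ioi 0)
    (h : ∀ β ∈ interior D, β * ((∫ V, (Matrix.trace (1 - (V : Matrix (Fin N) (Fin N) ℂ))).re * Real.exp (-(β * (Matrix.trace (1 - (V : Matrix (Fin N) (Fin N) ℂ))).re)) ∂(haarProbability (Matrix.specialUnitaryGroup (Fin N) ℂ))) / ∫ V, Real.exp (-(β * (Matrix.trace (1 - (V : Matrix (Fin N) (Fin N) ℂ))).re)) ∂(haarProbability (Matrix.specialUnitaryGroup (Fin N) ℂ)))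
      ≤ ((N ^ 2 - 1 : ℕ) : ℝ) / 2) :
    MonotoneOn (fun β : ℝ => Real.sqrt β ^ (N ^ 2 - 1) * ∫ V, Real.exp (-(β * (Matrix.trace (1 - (V : Matrix (Fin N) (Fin N) ℂ))).re)) ∂(haarProbability (Matrix.specialUnitaryGroup (Fin N) ℂ))) D := by
  -- the logarithm of the scaled mass is non-decreasing on `D`
  have hg : MonotoneOn (fun β : ℝ => ((N ^ 2 - 1 : ℕ) : ℝ) / 2 * Real.log β + Real.log (∫ V, Real.exp (-(β * (Matrix.trace (1 - (V : Matrix (Fin N) (Fin N) ℂ))).re)) ∂(haarProbability (Matrix.specialUnitaryGroup (Fin N) ℂ)))) D := by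
    refine monotoneOn_of_hasDerivWithinAt_nonneg hDc (fun β hβ => (hasDerivAt_log_scaled_plaquetteMass_SUN (hD0 hβ)).continuousAt.continuousWithinAt)
      (fun β hβ => (hasDerivAt_log_scaled_plaquetteMass_SUN (hD0 (interior_subset hβ))).hasDerivWithinAt) (fun β hβ => ?_)
    have hβ0 : 0 < β := hD0 (interior_subset hβ)
    have h1 := h β hβ
    rw [mul_comm, ← le_div_iff₀ hβ0, show ((N ^ 2 - 1 : ℕ) : ℝ) / 2 / β = ((N ^ 2 - 1 : ℕ) : ℝ) / 2 * β⁻¹ from div_eq_mul_inv _ _] at h1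
    rw [neg_div]
    linarith
  intro a ha b hb hab
  show Real.sqrt a ^ (N ^ 2 - 1) * _ ≤ Real.sqrt b ^ (N ^ 2 - 1) * _
  rw [scaled_plaquetteMass_SUN_eq_exp (hD0 ha), scaled_plaquetteMass_SUN_eq_exp (hD0 hb), Real.exp_le_exp]
  exact hg ha hb hab

/-- **MONOTONICITY ⟺ EQUIPARTITION INEQUALITY, EVERY `N`.**  `β ↦ (√β)^{N²−1}·∫ e^{−β·Re tr(1−V)} dHaar_{SU(N)}(V)` is non-decreasing on `(0,∞)` IF AND ONLY IF
`β·∫ Re tr(1−V)·e^{−β·Re tr(1−V)} dHaar ∕ ∫ e^{−β·Re tr(1−V)} dHaar ≤ (N²−1)∕2` for every `β > 0` — the tilted mean plaquette action never exceeds its equipartition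
value `dim SU(N)∕(2β)` (J4: `β⟨s⟩_β → (N²−1)∕2` as `β → ∞`; V44 §8: `< 3∕2` at every `β` for `N = 2`).  (⇒: a non-decreasing function's derivative is `≥ 0` at an
accumulation point, Mathlib `HasDerivWithinAt.nonneg_of_monotoneOn`; ⇐: the local form.) [folklore] -/
theorem scaled_plaquetteMass_SUN_monotoneOn_iff_equipartition_le :
    MonotoneOn (fun β : ℝ => Real.sqrt β ^ (N ^ 2 - 1) * ∫ V, Real.exp (-(β * (Matrix.trace (1 - (V : Matrix (Fin N) (Fin N) ℂ))).re)) ∂(haarProbability (Matrix.specialUnitaryGroup (Fin N) ℂ))) (Set.Ioi 0) ↔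
    ∀ β : ℝ, 0 < β → β * ((∫ V, (Matrix.trace (1 - (V : Matrix (Fin N) (Fin N) ℂ))).re * Real.exp (-(β * (Matrix.trace (1 - (V : Matrix (Fin N) (Fin N) ℂ))).re)) ∂(haarProbability (Matrix.specialUnitaryGroup (Fin N) ℂ))) / ∫ V, Real.exp (-(β * (Matrix.trace (1 - (V : Matrix (Fin N) (Fin N) ℂ))).re)) ∂(haarProbability (Matrix.specialUnitaryGroup (Fin N) ℂ)))
      ≤ ((N ^ 2 - 1 : ℕ) : ℝ) / 2 := by
  constructor
  · intro hmono β hβ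
    -- the logarithm of the scaled mass is non-decreasing on `(0,∞)`
    have hg : MonotoneOn (fun β : ℝ => ((N ^ 2 - 1 : ℕ) : ℝ) / 2 * Real.log β + Real.log (∫ V, Real.exp (-(β * (Matrix.trace (1 - (V : Matrix (Fin N) (Fin N) ℂ))).re)) ∂(haarProbability (Matrix.specialUnitaryGroup (Fin N) ℂ)))) (Set.Ioi 0) := by
      intro a ha b hb hab
      have h1 := hmono ha hb hab
      simp only at h1
      rwa [scaled_plaquetteMass_SUN_eq_exp (show 0 < a from ha), scaled_plaquetteMass_SUN_eq_exp (show 0 < b from hb), Real.exp_le_exp] at h1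
    -- `β` is an accumulation point of `(0,∞)`
    have hacc : AccPt β (𝓟 (Set.Ioi (0 : ℝ))) := by
      rw [accPt_principal_iff_nhdsWithin]
      have hsub : Set.Ioi β ⊆ Set.Ioi 0 \ {β} := fun y hy => ⟨lt_trans hβ hy, fun h => ne_of_gt (Set.mem_Ioi.1 hy) (Set.mem_singleton_iff.1 h)⟩
      exact (inferInstance : (𝓝[>] β).NeBot).mono (nhdsWithin_mono β hsub)
    have h0 := ((hasDerivAt_log_scaled_plaquetteMass_SUN (N := N) hβ).hasDerivWithinAt (s := Set.Ioi 0)).nonneg_of_monotoneOn hacc hg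
    rw [neg_div] at h0
    rw [mul_comm, ← le_div_iff₀ hβ, show ((N ^ 2 - 1 : ℕ) : ℝ) / 2 / β = ((N ^ 2 - 1 : ℕ) : ℝ) / 2 * β⁻¹ from div_eq_mul_inv _ _]
    linarith
  · intro h
    refine scaled_plaquetteMass_SUN_monotoneOn_of_equipartition_le (convex_Ioi 0) subset_rfl fun β hβ => h β ?_
    rwa [interior_Ioi] at hβ

/-- **THE SHARP DOUBLING GIVES THE EQUIPARTITION INEQUALITY, EVERY `N`**: V38's doubling with `D = 1` ⟹ `β·⟨Re tr(1−V)⟩_β ≤ (N²−1)∕2` at every `β > 0`. [folklore] -/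
theorem equipartition_le_of_doubling_one (hD : ∀ l : ℝ, 1 ≤ l → ∀ t : ℝ,
      (haarProbability (Matrix.specialUnitaryGroup (Fin N) ℂ)).real {V : Matrix.specialUnitaryGroup (Fin N) ℂ | (Matrix.trace (1 - (V : Matrix (Fin N) (Fin N) ℂ))).re ≤ l ^ 2 * t} ≤ l ^ (N ^ 2 - 1) * (haarProbability (Matrix.specialUnitaryGroup (Fin N) ℂ)).real {V : Matrix.specialUnitaryGroup (Fin N) ℂ | (Matrix.trace (1 - (V : Matrix (Fin N) (Fin N) ℂ))).re ≤ t})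
    {β : ℝ} (hβ : 0 < β) :
    β * ((∫ V, (Matrix.trace (1 - (V : Matrix (Fin N) (Fin N) ℂ))).re * Real.exp (-(β * (Matrix.trace (1 - (V : Matrix (Fin N) (Fin N) ℂ))).re)) ∂(haarProbability (Matrix.specialUnitaryGroup (Fin N) ℂ))) / ∫ V, Real.exp (-(β * (Matrix.trace (1 - (V : Matrix (Fin N) (Fin N) ℂ))).re)) ∂(haarProbability (Matrix.specialUnitaryGroup (Fin N) ℂ))) ≤ ((N ^ 2 - 1 : ℕ) : ℝ) / 2 :=
  scaled_plaquetteMass_SUN_monotoneOn_iff_equipartition_le.1 (scaled_plaquetteMass_SUN_monotoneOn_of_doubling_one hD) β hβ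

end Equipartition

/-! ## §4 Every `N`, unconditionally: monotonicity on the FREE-ENERGY WINDOW `{β ≥ 0 ∣ −log Z_N(β) ≤ (N²−1)∕2}` ⊇ `[0, (N²−1)∕(2N)]` -/

section FreeEnergyWindow

variable {N : ℕ}

/-- The positive part of the free-energy window `{β > 0 ∣ −log Z_N(β) ≤ (N²−1)∕2}` is order-connected (an interval): `−log Z_N` is non-decreasing on `[0,∞)` (V50). [folklore] -/
theorem freeEnergyWindow_ordConnected : Set.OrdConnected {β : ℝ | 0 < β ∧ -Real.log (∫ V, Real.exp (-(β * (Matrix.trace (1 - (V : Matrix (Fin N) (Fin N) ℂ))).re)) ∂(haarProbability (Matrix.specialUnitaryGroup (Fin N) ℂ))) ≤ ((N ^ 2 - 1 : ℕ) : ℝ) / 2} := by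
  rw [Set.ordConnected_iff]
  intro _ hx _ hy _ z hz
  refine ⟨hx.1.trans_le hz.1, le_trans ?_ hy.2⟩
  exact freeEnergy_SUN_monotoneOn (N := N) (show (0 : ℝ) ≤ z from (hx.1.trans_le hz.1).le) (show (0 : ℝ) ≤ _ from (hx.1.trans_le (hz.1.trans hz.2)).le) hz.2

/-- **MONOTONICITY ON THE FREE-ENERGY WINDOW, EVERY `N`, UNCONDITIONALLY** (positive part): `β ↦ (√β)^{N²−1}·Z_N(β)` is non-decreasing on `{β > 0 ∣ −log Z_N(β) ≤ (N²−1)∕2}` —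
there `β·⟨Re tr(1−V)⟩_β ≤ −log Z_N(β) ≤ (N²−1)∕2` by V49's tangent-line Jensen `mul_meanAction_le_freeEnergy` (concavity of the free energy), so the local criterion of §3 applies:
the scaled mass rises as long as the one-plaquette free energy is below its equipartition value `½·dim SU(N)`. [folklore] -/
theorem scaled_plaquetteMass_SUN_monotoneOn_freeEnergyWindow_pos :
    MonotoneOn (fun β : ℝ => Real.sqrt β ^ (N ^ 2 - 1) * ∫ V, Real.exp (-(β * (Matrix.trace (1 - (V : Matrix (Fin N) (Fin N) ℂ))).re)) ∂(haarProbability (Matrix.specialUnitaryGroup (Fin N) ℂ))) {β : ℝ | 0 < β ∧ -Real.log (∫ V, Real.exp (-(β * (Matrix.trace (1 - (V : Matrix (Fin N) (Fin N) ℂ))).re)) ∂(haarProbability (Matrix.specialUnitaryGroup (Fin N) ℂ))) ≤ ((N ^ 2 - 1 : ℕ) : ℝ) / 2} := by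
  refine scaled_plaquetteMass_SUN_monotoneOn_of_equipartition_le freeEnergyWindow_ordConnected.convex (fun _ hβ => hβ.1) fun β hβ => ?_
  have hβ' := interior_subset hβ
  exact (mul_meanAction_le_freeEnergy hβ'.1.le).trans hβ'.2

/-- **MONOTONICITY ON THE FREE-ENERGY WINDOW, EVERY `N ≥ 2`, UNCONDITIONALLY**: `β ↦ (√β)^{N²−1}·Z_N(β)` is non-decreasing on `W_N = {β ≥ 0 ∣ −log Z_N(β) ≤ (N²−1)∕2}`, an
interval `[0, β*_N]` with `β*_N ≥ (N²−1)∕(2N)` (or `[0,∞)`). [folklore] -/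
theorem scaled_plaquetteMass_SUN_monotoneOn_freeEnergyWindow (hN : 2 ≤ N) :
    MonotoneOn (fun β : ℝ => Real.sqrt β ^ (N ^ 2 - 1) * ∫ V, Real.exp (-(β * (Matrix.trace (1 - (V : Matrix (Fin N) (Fin N) ℂ))).re)) ∂(haarProbability (Matrix.specialUnitaryGroup (Fin N) ℂ))) {β : ℝ | 0 ≤ β ∧ -Real.log (∫ V, Real.exp (-(β * (Matrix.trace (1 - (V : Matrix (Fin N) (Fin N) ℂ))).re)) ∂(haarProbability (Matrix.specialUnitaryGroup (Fin N) ℂ))) ≤ ((N ^ 2 - 1 : ℕ) : ℝ) / 2} :=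
  monotoneOn_insert_zero (T := {β : ℝ | 0 < β ∧ -Real.log (∫ V, Real.exp (-(β * (Matrix.trace (1 - (V : Matrix (Fin N) (Fin N) ℂ))).re)) ∂(haarProbability (Matrix.specialUnitaryGroup (Fin N) ℂ))) ≤ ((N ^ 2 - 1 : ℕ) : ℝ) / 2})
    (fun _ hx => hx.1.eq_or_lt.imp Eq.symm (fun h => ⟨h, hx.2⟩)) (fun _ hx => hx.1) scaled_plaquetteMass_SUN_monotoneOn_freeEnergyWindow_pos
    (scaled_plaquetteMass_SUN_zero hN) (fun x _ => scaled_plaquetteMass_SUN_nonneg x)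

/-- The strong-coupling window lies inside the free-energy window: for `N ≥ 2` and `β ≤ (N²−1)∕(2N)`, `−log Z_N(β) ≤ N·β ≤ (N²−1)∕2` (V50's `freeEnergy_SUN_le`). [folklore] -/
theorem freeEnergy_le_of_strongCoupling (hN : 2 ≤ N) {β : ℝ} (hβb : β ≤ ((N ^ 2 - 1 : ℕ) : ℝ) / (2 * N)) : -Real.log (∫ V, Real.exp (-(β * (Matrix.trace (1 - (V : Matrix (Fin N) (Fin N) ℂ))).re)) ∂(haarProbability (Matrix.specialUnitaryGroup (Fin N) ℂ))) ≤ ((N ^ 2 - 1 : ℕ) : ℝ) / 2 := by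
  have hN0 : (0 : ℝ) < N := by exact_mod_cast (show 0 < N by omega)
  calc -Real.log (∫ V, Real.exp (-(β * (Matrix.trace (1 - (V : Matrix (Fin N) (Fin N) ℂ))).re)) ∂(haarProbability (Matrix.specialUnitaryGroup (Fin N) ℂ))) ≤ N * β := freeEnergy_SUN_le hN β
    _ ≤ N * (((N ^ 2 - 1 : ℕ) : ℝ) / (2 * N)) := mul_le_mul_of_nonneg_left hβb hN0.le
    _ = ((N ^ 2 - 1 : ℕ) : ℝ) / 2 := by field_simp

/-- **UNCONDITIONAL MONOTONICITY AT STRONG COUPLING, EVERY `N ≥ 2`**: `β ↦ (√β)^{N²−1}·∫ e^{−β·Re tr(1−V)} dHaar_{SU(N)}(V)` is non-decreasing on the explicit window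
`[0, (N²−1)∕(2N)]` (`N = 2`: `[0, 3∕4]`; `N = 3`: `[0, 4∕3]`; large `N`: `[0, ≈ N∕2]`). [folklore] -/
theorem scaled_plaquetteMass_SUN_monotoneOn_strongCoupling (hN : 2 ≤ N) :
    MonotoneOn (fun β : ℝ => Real.sqrt β ^ (N ^ 2 - 1) * ∫ V, Real.exp (-(β * (Matrix.trace (1 - (V : Matrix (Fin N) (Fin N) ℂ))).re)) ∂(haarProbability (Matrix.specialUnitaryGroup (Fin N) ℂ))) (Set.Icc 0 (((N ^ 2 - 1 : ℕ) : ℝ) / (2 * N))) :=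
  (scaled_plaquetteMass_SUN_monotoneOn_freeEnergyWindow hN).mono fun _ hβ => ⟨hβ.1, freeEnergy_le_of_strongCoupling hN hβ.2⟩

end FreeEnergyWindow

/-! ## §5 The global ceiling from quasi-monotonicity and a limit -/

section Ceiling

variable {N : ℕ}

/-- A `D`-quasi-non-decreasing real function on `(0,∞)` with a limit `c` at `∞` is bounded by `D·c` on `(0,∞)`. [folklore] -/
theorem le_mul_lim_of_quasiMonotone {f : ℝ → ℝ} {D c : ℝ} (hq : ∀ β₁ β₂ : ℝ, 0 < β₁ → β₁ ≤ β₂ → f β₁ ≤ D * f β₂)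
    (hc : Tendsto f atTop (𝓝 c)) {β : ℝ} (hβ : 0 < β) : f β ≤ D * c :=
  ge_of_tendsto (hc.const_mul D) (Filter.eventually_atTop.2 ⟨β, fun β₂ h => hq β β₂ hβ h⟩)

/-- **THE GLOBAL CEILING AT THE SHARP RATE WITH THE LIMIT CONSTANT, EVERY `N`**: if `(√β)^{N²−1}·Z_N(β) → c` as `β → ∞` (J4 ∕ seat ne8's file 46: `c = K_N =
G(N+1)∕(√N·(2π)^{(N−1)∕2})`, a HYPOTHESIS here), then with V38's doubling constant `D`: `(√β)^{N²−1}·Z_N(β) ≤ D·c` at EVERY `β > 0`. [folklore] -/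
theorem scaled_plaquetteMass_SUN_le_mul_lim {c : ℝ}
    (hc : Tendsto (fun β : ℝ => Real.sqrt β ^ (N ^ 2 - 1) * ∫ V, Real.exp (-(β * (Matrix.trace (1 - (V : Matrix (Fin N) (Fin N) ℂ))).re)) ∂(haarProbability (Matrix.specialUnitaryGroup (Fin N) ℂ))) atTop (𝓝 c)) :
    ∃ D : ℝ, 1 ≤ D ∧ ∀ β : ℝ, 0 < β → Real.sqrt β ^ (N ^ 2 - 1) * ∫ V, Real.exp (-(β * (Matrix.trace (1 - (V : Matrix (Fin N) (Fin N) ℂ))).re)) ∂(haarProbability (Matrix.specialUnitaryGroup (Fin N) ℂ)) ≤ D * c := by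
  obtain ⟨D, hD1, hq⟩ := exists_scaled_plaquetteMass_SUN_quasiMonotone (N := N)
  exact ⟨D, hD1, fun β hβ => le_mul_lim_of_quasiMonotone hq hc hβ⟩

end Ceiling

/-! ## §6 Sanity: `N = 2` from V40b-Haar's sharp doubling (V44's statements reached without Weyl's derivative formula; `example`s, nothing restated) -/

section SanityN2

/-- `N = 2`: the scaled mass `(√β)³·Z_{SU(2)}(β)` is non-decreasing on `[0,∞)` — V44's `scaled_plaquetteMass_SU2_monotoneOn`, by §2 from V40b-Haar's `D = 1`. -/
example : MonotoneOn (fun β : ℝ => Real.sqrt β ^ 3 * ∫ U, Real.exp (-(β * (Matrix.trace (1 - (U : Matrix (Fin 2) (Fin 2) ℂ))).re)) ∂(haarProbability (Matrix.specialUnitaryGroup (Fin 2) ℂ))) (Set.Ici 0) := by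
  have h := scaled_plaquetteMass_SUN_monotoneOn_Ici_of_doubling_one (N := 2) le_rfl (fun l hl t => by simpa using haarReal_traceWindow_doubling_one hl t)
  simpa using h

/-- `N = 2`: the equipartition inequality `β·⟨Re tr(1−U)⟩_β ≤ 3∕2` at every `β > 0` — V44 §8's `mean_action_lt_equipartition` in its non-strict form, by §3. -/
example {β : ℝ} (hβ : 0 < β) :
    β * ((∫ U, (Matrix.trace (1 - (U : Matrix (Fin 2) (Fin 2) ℂ))).re * Real.exp (-(β * (Matrix.trace (1 - (U : Matrix (Fin 2) (Fin 2) ℂ))).re)) ∂(haarProbability (Matrix.specialUnitaryGroup (Fin 2) ℂ))) / ∫ U, Real.exp (-(β * (Matrix.trace (1 - (U : Matrix (Fin 2) (Fin 2) ℂ))).re)) ∂(haarProbability (Matrix.specialUnitaryGroup (Fin 2) ℂ))) ≤ 3 / 2 := by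
  have h := equipartition_le_of_doubling_one (N := 2) (fun l hl t => by simpa using haarReal_traceWindow_doubling_one hl t) hβ
  have e : ((2 ^ 2 - 1 : ℕ) : ℝ) / 2 = 3 / 2 := by norm_num
  rwa [e] at h

end SanityN2

end Summit.QuantumFields.BalabanUV.T4Continuum.NE7b.CompactFibrePlaquetteMassSUNQuasiMonotone

end
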